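import Summits.MatrixMultiplication.OmegaCensus.STPPVosperSlackTwoCheckersT
import Summits.MatrixMultiplication.OmegaCensus.STPPVosperSlackFourTablesZ61P1
import Summits.MatrixMultiplication.OmegaCensus.STPPVosperSlackTwoLawABQ

/-!
# ω-census (abelian STPP census): fifth leaf ℤ₆₁ {(2,2,2),(3,3,3)²} (slack 4) — cells δ₁ = 0 / δ₂′ = 0: `caseADeadT` rows up to dihedral symmetry, part 1 of 1 (kernel computations)

HONEST FRAMING (pub-omega census; verbatim): lottery ticket; floor = certified bounds/negative ranges.
Census STRUCTURE (seat pub-omega-stpp-2 gen 27 — rows service for the stpp-1 lineage's law, 2026-08-29), family (b2).  Rows for stpp-1 g33's slack-4 law `no_isSTPP_of_slack_four_tables_of_cell22` (`STPPVosperSlackFourLawT.lean`), hypotheses `rowsA0` and (by the leaf's role symmetry) `rowsB0`: block i = a (3,3,3) block read (a,b,c) = (3,3,3), others (2,2,2),(3,3,3), L = z = 13; Vosper cells: `dihedralSmaller 61 Q || caseADeadT 61 3 3 13 13 Q tblZ61F5A0` over the 1 770 three-shapes (310 representatives; stpp-1 g33 mirror ≈ 40k nodes).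
Each theorem is ONE `decide +kernel` over one chunk (sized by a python cost mirror to stay under the default-heartbeat ceiling).
Assembly in `STPPVosperSlackFourRows61F5A0Asm.lean`.  Nothing here is progress on `ω`.
-/

namespace Summit.MatrixMultiplication.OmegaCensus.CubeNB.S2

/-- Rows chunk `[0, 1213)`: every entry passes the kernel test. [folklore] -/
theorem rows61F5A0_c0 : ((qShapes 61 3 0 1213).all fun Q => dihedralSmaller 61 Q || caseADeadT 61 3 3 13 13 Q tblZ61F5A0) = true := by
  decide +kernel

/-- Rows chunk `[1213, 1460)`: every entry passes the kernel test. [folklore] -/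
theorem rows61F5A0_c1 : ((qShapes 61 3 1213 1460).all fun Q => dihedralSmaller 61 Q || caseADeadT 61 3 3 13 13 Q tblZ61F5A0) = true := by
  decide +kernel

/-- Rows chunk `[1460, 1633)`: every entry passes the kernel test. [folklore] -/
theorem rows61F5A0_c2 : ((qShapes 61 3 1460 1633).all fun Q => dihedralSmaller 61 Q || caseADeadT 61 3 3 13 13 Q tblZ61F5A0) = true := by
  decide +kernel

/-- Rows chunk `[1633, 1770)`: every entry passes the kernel test. [folklore] -/
theorem rows61F5A0_c3 : ((qShapes 61 3 1633 1770).all fun Q => dihedralSmaller 61 Q || caseADeadT 61 3 3 13 13 Q tblZ61F5A0) = true := by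
  decide +kernel

end Summit.MatrixMultiplication.OmegaCensus.CubeNB.S2
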